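/-
Copyright (c) 2026. All rights reserved.
Released under Apache 2.0 license as described in the file LICENSE.
Authors: abc-iut cell, Cor. 3.12 sub-crew seat abc-iut-c312-1 (gen 24).
-/
import Literature.IUT.LogVolume.LogUnitsTraceTopShellDyadicSqrtNegOne
import Literature.IUT.LogVolume.TensorPacketVolume
import Literature.IUT.LogVolume.TensorPacketShellHull
import Literature.IUT.LogVolume.PacketDifferent
import HarnessLib

/-!
# On a tensor packet `⊗_{ℚ₂} K_b` all of whose factors are `≅ ℚ₂(√−1)` the TRACE DETECTS THE TOP POLYSHELL of the log-shell lattice: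
# trace-zero elements of `log₂(R_I^×)` are one shell short in EVERY component (classical 2-adic algebra; packet form of
# `LogUnitsTraceZeroDyadicSqrtNegOne` / `LogUnitsTraceTopShellDyadicSqrtNegOne`)

abc-iut cell, PROOF-ONLY classical local algebra (Cor. 3.12 sub-crew, seat abc-iut-c312-1 gen 24, row «C:P2-PACKET-HULL-GAP», file 2/3; no
definition, no `Prop` fact, no instance, no notation).  Setting: a finite family of `2`-adic fields `K_b` (`b ∈ I`) in the campaign-S class, each
containing `i_b` with `i_b² = −1` and of invariants `(e, f) = (2, 1)` (`K_b ≅ ℚ₂(√−1)`, `log₂(𝒪_{K_b}^×) = 𝔪_b³`), uniformizers `ϖ_b`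
(`‖ϖ_b‖ = 2^{−1/2}` for every `b`); the packet algebra `V = ⊗_{ℚ₂} K_b` (abc-iut-S6 `PacketAlgebra`), its log-shell lattice `log₂(R_I^×)`
(`logPacket`, generated by the pure tensors of unit logarithms) and ANY decomposition `ψ : V ≃ₐ Π_j L_j` into local fields (abc-iut-S8).

WHY (the consumer, `Summits/ABC/IUTFork/Thm311RealInd1StripPacketHullDyadic`): the PACKET HULL WASHOUT `Thm311RealInd1StripPacketHullWashout`
(R20: `packetHull(c·(log_p(R_I^×) ∩ Ker Tr_V)) = packetHull(c·log_p(R_I^×))` as soon as ONE factor is tame of degree `≥ 2`) and the packet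
ceiling of print's factorwise (Ind1)⊔(Ind2) group (`Thm311RealInd1StripPacketCeiling`: the group multiplies `Tr_V` by a unit, so its orbit of
`M ⊆ c·log_p(R_I^×)` stays in `M + c·(log_p(R_I^×) ∩ Ker Tr_V)`) leave the all-wild packets untreated.  At a packet all of whose factors are
`ℚ₂(√−1)` the washout FAILS, for the following classical reason proved here from the one-factor congruence `z ≡ (Tr z/Tr ϖ³)·ϖ³ (mod 𝔪⁴)`
(`norm_sub_traceRatio_smul_le`, file 1/3):

* `prod_norm_sub_prod_le` (private; ultrametric perturbation of a product) and the closure induction over pure tensors give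
  **`norm_psi_sub_traceRatio_smul_le_of_mem_logPacket`**: with `π := ⊗_b ϖ_b³ ∈ log₂(R_I^×)` (`purePacket_pow_three_mem_logPacket_and_norm`:
  `‖ψ(π)_j‖ = ρ^{3n}`, `ρ = ‖ϖ_b‖`, `n = #I`, the container's top) and `Θ := Tr_V(π) = Π_b Tr(ϖ_b³) ≠ 0`, EVERY `x ∈ log₂(R_I^×)` satisfies, in
  EVERY component `j`, `‖ψ(x)_j − (Tr_V(x)/Θ)·ψ(π)_j‖ ≤ ρ^{3n+1}` and `‖Tr_V(x)‖ ≤ ‖Θ‖`;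
* consequences: **`norm_psi_le_of_mem_logPacket_of_trace_eq_zero`** — a TRACE-ZERO element of the log-shell lattice has ALL components of norm
  `≤ ρ^{3n+1} < ρ^{3n}` (one shell short everywhere), and the dichotomy **`norm_psi_eq_top_iff_of_mem_logPacket`** — `‖ψ(x)_j‖ = ρ^{3n}` ⟺
  `‖Tr_V(x)‖ = ‖Θ‖` (so all components are top, or none is).
READING (classical; numbers about `ℚ₂(√−1)`-packets only): the trace-zero hyperplane section of `log₂(R_I^×)` — the lineage's packet ceiling
direction — misses the container's top polyshell in every component, at every factor count `n`; what this does to packet hulls and to the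
orbit of print's factorwise group is the consumer's business.  HONEST SCOPE: classical; ALL factors of shape `(e, f) = (2, 1)` with `√−1` (mixed
dyadic packets NOT treated); nothing here mentions a log-volume or print's indeterminacies; no side taken on [IUTchIII] Cor. 3.12; NO abc claim.
[cite: NeukirchANT1999, Ch. II Prop. (5.5), (5.7)] [cite: SerreLocalFields1979, Ch. III §3, Prop. 7] [cite: Mochizuki2012, IUTchIV Prop. 1.2 (i) p. 10;
Prop. 1.4 (i) p. 13] [claim: Mochizuki2012, status: disputed]
-/

set_option autoImplicit false

noncomputable section

open Metric Set Module
open scoped Pointwise TensorProduct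

namespace Literature.IUT.LogVolume

namespace TraceZeroDyadicSqrtNegOne

open Literature.NumberTheory.GaloisRepresentations.Ultrametric RamificationCriterion

/-- A `2`-adic number of norm `< 1` has norm `≤ 1/2`. [folklore] -/
private theorem padic_norm_le_half_of_norm_lt_one' {a : ℚ_[2]} (ha : ‖a‖ < 1) : ‖a‖ ≤ 2⁻¹ := by
  have h := (Padic.norm_le_pow_iff_norm_lt_pow_add_one a (-1)).mpr (by simpa using ha)
  simpa using h

/-! ## §2 The packet: all factors `≅ ℚ₂(√−1)` -/

section Packet

variable {I : Type} [Fintype I] [DecidableEq I]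
variable (k : I → Type) [∀ b, NontriviallyNormedField (k b)] [∀ b, NormedAlgebra ℚ_[2] (k b)]
  [∀ b, IsUltrametricDist (k b)] [∀ b, ProperSpace (k b)]
variable {J : Type} (L : J → Type) [∀ j, NontriviallyNormedField (L j)] [∀ j, NormedAlgebra ℚ_[2] (L j)]
  [∀ j, IsUltrametricDist (L j)]
variable (ψ : PacketAlgebra 2 k ≃ₐ[ℚ_[2]] (Π j, L j))
variable {ι : Π b, k b} (hι : ∀ b, ι b ^ 2 = -1) (he : ∀ b, absRamificationIdx 2 (k b) = 2) (hf : ∀ b, residueDegree 2 (k b) = 1)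
  {ϖ : Π b, (k b)ˣ} (hϖ : ∀ b, IsUniformizer (ϖ b))

omit [Fintype I] [∀ j, NormedAlgebra ℚ_[2] (L j)] in
/-- **Ultrametric perturbation of a product**: if `‖a_b‖ ≤ α` and `‖e_b‖ ≤ δ ≤ α` for `b ∈ s`, then `‖Π_{s}(a_b + e_b) − Π_{s} a_b‖ ≤ δ·α^{#s−1}`.
[folklore] -/
private theorem prod_norm_sub_prod_le {j : J} (a e : I → L j) {α δ : ℝ} (hδ0 : 0 ≤ δ) (hδα : δ ≤ α) (s : Finset I)
    (ha : ∀ b ∈ s, ‖a b‖ ≤ α) (he' : ∀ b ∈ s, ‖e b‖ ≤ δ) :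
    ‖∏ b ∈ s, (a b + e b) - ∏ b ∈ s, a b‖ ≤ δ * α ^ (s.card - 1) := by
  have hα0 : 0 ≤ α := hδ0.trans hδα
  induction s using Finset.induction_on with
  | empty => simp [hδ0]
  | insert b s hb ih =>
    have ha' : ∀ b' ∈ s, ‖a b'‖ ≤ α := fun b' hb' => ha b' (Finset.mem_insert_of_mem hb')
    have he'' : ∀ b' ∈ s, ‖e b'‖ ≤ δ := fun b' hb' => he' b' (Finset.mem_insert_of_mem hb')
    have hab : ‖a b‖ ≤ α := ha b (Finset.mem_insert_self b s)
    have heb : ‖e b‖ ≤ δ := he' b (Finset.mem_insert_self b s)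
    have hP : ‖∏ b' ∈ s, a b'‖ ≤ α ^ s.card := by
      rw [norm_prod]; exact le_of_le_of_eq (Finset.prod_le_prod (fun _ _ => norm_nonneg _) ha') (Finset.prod_const α)
    have hPE : ‖∏ b' ∈ s, (a b' + e b')‖ ≤ α ^ s.card := by
      rw [norm_prod]
      refine le_of_le_of_eq (Finset.prod_le_prod (fun _ _ => norm_nonneg _) fun b' hb' => ?_) (Finset.prod_const α)
      exact (IsUltrametricDist.norm_add_le_max _ _).trans (max_le (ha' b' hb') ((he'' b' hb').trans hδα))
    rw [Finset.prod_insert hb, Finset.prod_insert hb, Finset.card_insert_of_notMem hb, Nat.add_sub_cancel]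
    -- `(a+e)·Q − a·P = a·(Q − P) + e·Q`
    have hsplit : (a b + e b) * ∏ b' ∈ s, (a b' + e b') - a b * ∏ b' ∈ s, a b' =
        a b * (∏ b' ∈ s, (a b' + e b') - ∏ b' ∈ s, a b') + e b * ∏ b' ∈ s, (a b' + e b') := by ring
    rw [hsplit]
    refine (IsUltrametricDist.norm_add_le_max _ _).trans (max_le ?_ ?_)
    · rw [norm_mul]
      rcases s.eq_empty_or_nonempty with hs | hs
      · simp [hs, hδ0]
      · have hcard : 1 ≤ s.card := Finset.card_pos.mpr hs
        calc ‖a b‖ * ‖∏ b' ∈ s, (a b' + e b') - ∏ b' ∈ s, a b'‖ ≤ α * (δ * α ^ (s.card - 1)) :=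
            mul_le_mul hab (ih ha' he'') (norm_nonneg _) hα0
          _ = δ * α ^ s.card := by
            rw [mul_left_comm, ← pow_succ', Nat.sub_add_cancel hcard]
    · rw [norm_mul]
      exact mul_le_mul heb hPE (norm_nonneg _) hδ0

omit [Fintype I] [DecidableEq I] in
include hϖ he in
/-- All the uniformizer norms agree: `‖ϖ_b‖ = ‖ϖ_{b'}‖` (`= 2^{−1/2}`). [cite: NeukirchANT1999, Ch. II Prop. (5.5)] -/
theorem norm_uniformizer_eq (b b' : I) : ‖(ϖ b : k b)‖ = ‖(ϖ b' : k b')‖ :=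
  (sq_eq_sq₀ (norm_nonneg _) (norm_nonneg _)).mp (by rw [WildQuadraticDyadic.norm_unif_sq (hϖ b) (he b), WildQuadraticDyadic.norm_unif_sq (hϖ b') (he b')])

omit [∀ j, IsUltrametricDist (L j)] in
include hϖ hι he hf in
/-- `π := ⊗_b ϖ_b³` lies in `log₂(R_I^×)` and `‖ψ(π)_j‖ = ‖ϖ_{b₀}‖^{3n}` in every component (`n = #I`): the container's top polyshell is
attained. [cite: Mochizuki2012, IUTchIV Prop. 1.2 (i) p. 10; Prop. 1.4 (i) p. 13] [claim: Mochizuki2012, status: disputed] -/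
theorem purePacket_pow_three_mem_logPacket_and_norm (b₀ : I) (j : J) :
    purePacket 2 k (fun b => (ϖ b : k b) ^ 3) ∈ logPacket 2 k ∧
      ‖ψ (purePacket 2 k (fun b => (ϖ b : k b) ^ 3)) j‖ = ‖(ϖ b₀ : k b₀)‖ ^ (3 * Fintype.card I) := by
  refine ⟨purePacket_mem_logPacket_of_mem 2 k fun b => ?_, ?_⟩
  · rw [DyadicNoFixedBall.logUnits_eq_closedBall_cube_of_sq_eq_neg_one (hϖ b) (hι b) (he b) (hf b), mem_closedBall_zero_iff, norm_pow]
  · rw [psi_purePacket_apply, norm_prod]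
    simp_rw [norm_factorEmb, norm_pow]
    rw [Finset.prod_congr rfl fun b _ => by rw [norm_uniformizer_eq k he hϖ b b₀], Finset.prod_const, Finset.card_univ, ← pow_mul,
      mul_comm]

omit [DecidableEq I] in
include hϖ hι he hf in
/-- `Θ := Tr_V(π) = Π_b Tr(ϖ_b³) ≠ 0`. [cite: NeukirchANT1999, Ch. II Prop. (5.5)] -/
theorem trace_purePacket_pow_three_ne_zero :
    Algebra.trace ℚ_[2] (PacketAlgebra 2 k) (purePacket 2 k (fun b => (ϖ b : k b) ^ 3)) ≠ 0 := by
  rw [trace_purePacket]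
  exact Finset.prod_ne_zero_iff.mpr fun b _ => trace_uniformizer_pow_three_ne_zero (hϖ b) (hι b) (he b) (hf b)

include hϖ hι he hf in
/-- **THE PACKET CONGRUENCE.**  On a packet all of whose factors are `≅ ℚ₂(√−1)`: with `π := ⊗_b ϖ_b³` and `Θ := Tr_V(π) ≠ 0`, every
`x ∈ log₂(R_I^×)` satisfies, in EVERY component `j` of ANY decomposition `ψ`, `‖ψ(x)_j − (Tr_V(x)/Θ)·ψ(π)_j‖ ≤ ‖ϖ‖^{3n+1}` and
`‖Tr_V(x)‖ ≤ ‖Θ‖` (pure tensors: §1 factor by factor + `prod_norm_sub_prod_le` + `Tr_V(⊗z_b) = Π Tr(z_b)`; then closure induction, the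
expression being additive in `x`). [cite: Mochizuki2012, IUTchIV Prop. 1.4 (i) p. 13] [cite: NeukirchANT1999, Ch. II Prop. (5.5), (5.7)]
[claim: Mochizuki2012, status: disputed] -/
theorem norm_psi_sub_traceRatio_smul_le_of_mem_logPacket (b₀ : I) {x : PacketAlgebra 2 k} (hx : x ∈ logPacket 2 k) (j : J) :
    ‖ψ x j - (Algebra.trace ℚ_[2] (PacketAlgebra 2 k) x /
        Algebra.trace ℚ_[2] (PacketAlgebra 2 k) (purePacket 2 k (fun b => (ϖ b : k b) ^ 3))) •
          ψ (purePacket 2 k (fun b => (ϖ b : k b) ^ 3)) j‖ ≤ ‖(ϖ b₀ : k b₀)‖ ^ (3 * Fintype.card I + 1) ∧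
      ‖Algebra.trace ℚ_[2] (PacketAlgebra 2 k) x‖ ≤
        ‖Algebra.trace ℚ_[2] (PacketAlgebra 2 k) (purePacket 2 k (fun b => (ϖ b : k b) ^ 3))‖ := by
  set π : PacketAlgebra 2 k := purePacket 2 k (fun b => (ϖ b : k b) ^ 3) with hπ
  set Θ : ℚ_[2] := Algebra.trace ℚ_[2] (PacketAlgebra 2 k) π with hΘ
  set TrV := Algebra.trace ℚ_[2] (PacketAlgebra 2 k) with hTrV
  set ρ : ℝ := ‖(ϖ b₀ : k b₀)‖ with hρ
  have hρ0 : 0 ≤ ρ := norm_nonneg _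
  have hΘ0 : Θ ≠ 0 := trace_purePacket_pow_three_ne_zero k hι he hf hϖ
  have hΘprod : Θ = ∏ b, Algebra.trace ℚ_[2] (k b) ((ϖ b : k b) ^ 3) := by rw [hΘ, hπ, trace_purePacket]
  -- the additive invariant
  induction hx using AddSubgroup.closure_induction with
  | mem t ht =>
    obtain ⟨z, hz, rfl⟩ := ht
    -- factorwise data
    have hρb : ∀ b, ‖(ϖ b : k b)‖ = ρ := fun b => norm_uniformizer_eq k he hϖ b b₀
    set lam : I → ℚ_[2] := fun b => Algebra.trace ℚ_[2] (k b) (z b) / Algebra.trace ℚ_[2] (k b) ((ϖ b : k b) ^ 3) with hlam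
    set a : I → L j := fun b => lam b • factorEmb 2 k L ψ b j ((ϖ b : k b) ^ 3) with ha
    set e : I → L j := fun b => factorEmb 2 k L ψ b j (z b - lam b • (ϖ b : k b) ^ 3) with he'
    have hsum : ∀ b, factorEmb 2 k L ψ b j (z b) = a b + e b := fun b => by
      simp only [ha, he', map_sub, map_smul]; abel
    have hab : ∀ b ∈ Finset.univ, ‖a b‖ ≤ ρ ^ 3 := fun b _ => by
      rw [ha]; dsimp only
      rw [norm_smul, norm_factorEmb, norm_pow, hρb]
      calc ‖lam b‖ * ρ ^ 3 ≤ 1 * ρ ^ 3 :=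
          mul_le_mul_of_nonneg_right (norm_traceRatio_le_one (hϖ b) (hι b) (he b) (hf b) (hz b)) (pow_nonneg hρ0 _)
        _ = ρ ^ 3 := one_mul _
    have heb : ∀ b ∈ Finset.univ, ‖e b‖ ≤ ρ ^ 4 := fun b _ => by
      rw [he']; dsimp only
      rw [norm_factorEmb]
      have h := norm_sub_traceRatio_smul_le (hϖ b) (hι b) (he b) (hf b) (hz b)
      rw [hρb, zpow_ofNat] at h
      exact h
    have hρ43 : ρ ^ 4 ≤ ρ ^ 3 := pow_le_pow_of_le_one hρ0 (by rw [hρ]; exact (hϖ b₀).1.le) (by norm_num)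
    -- the product identities
    have hprod_a : ∏ b, a b = (∏ b, lam b) • ψ π j := by
      rw [hπ, psi_purePacket_apply, Algebra.smul_def, map_prod, ← Finset.prod_mul_distrib]
      exact Finset.prod_congr rfl fun b _ => by rw [ha]; dsimp only; rw [Algebra.smul_def]
    have hlamprod : ∏ b, lam b = TrV (purePacket 2 k z) / Θ := by
      rw [hTrV, trace_purePacket, hΘprod, ← Finset.prod_div_distrib]
    refine ⟨?_, ?_⟩
    · rw [psi_purePacket_apply, Finset.prod_congr rfl fun b _ => hsum b, ← hlamprod, ← hprod_a]
      have h := prod_norm_sub_prod_le L a e (pow_nonneg hρ0 4) hρ43 Finset.univ hab heb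
      rw [Finset.card_univ] at h
      refine h.trans (le_of_eq ?_)
      rw [← pow_mul, ← pow_add]
      congr 1
      have : 1 ≤ Fintype.card I := Fintype.card_pos_iff.mpr ⟨b₀⟩
      omega
    · rw [hTrV, trace_purePacket, hΘprod, norm_prod, norm_prod]
      exact Finset.prod_le_prod (fun _ _ => norm_nonneg _) fun b _ => by
        have h1 := norm_traceRatio_le_one (hϖ b) (hι b) (he b) (hf b) (hz b)
        rwa [norm_div, div_le_one (norm_pos_iff.mpr (trace_uniformizer_pow_three_ne_zero (hϖ b) (hι b) (he b) (hf b)))] at h1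
  | zero =>
    refine ⟨?_, ?_⟩
    · rw [map_zero, map_zero, Pi.zero_apply, zero_div, zero_smul, sub_zero, norm_zero]; exact pow_nonneg hρ0 _
    · rw [map_zero, norm_zero]; exact norm_nonneg _
  | add x y _ _ hx hy =>
    refine ⟨?_, ?_⟩
    · have hsplit : ψ (x + y) j - (TrV (x + y) / Θ) • ψ π j =
          (ψ x j - (TrV x / Θ) • ψ π j) + (ψ y j - (TrV y / Θ) • ψ π j) := by
        rw [map_add, map_add, Pi.add_apply, add_div, add_smul]; abel
      rw [hsplit]
      exact (IsUltrametricDist.norm_add_le_max _ _).trans (max_le hx.1 hy.1)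
    · rw [map_add]
      exact (IsUltrametricDist.norm_add_le_max _ _).trans (max_le hx.2 hy.2)
  | neg x _ hx =>
    refine ⟨?_, ?_⟩
    · have hsplit : ψ (-x) j - (TrV (-x) / Θ) • ψ π j = -(ψ x j - (TrV x / Θ) • ψ π j) := by
        rw [map_neg, map_neg, Pi.neg_apply, neg_div, neg_smul]; abel
      rw [hsplit, norm_neg]; exact hx.1
    · rw [map_neg, norm_neg]; exact hx.2

include hϖ hι he hf in
/-- **TRACE-ZERO ELEMENTS OF THE LOG-SHELL LATTICE ARE ONE SHELL SHORT IN EVERY COMPONENT.**  On a packet all of whose factors are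
`≅ ℚ₂(√−1)`: `x ∈ log₂(R_I^×)`, `Tr_V(x) = 0` ⟹ `‖ψ(x)_j‖ ≤ ‖ϖ‖^{3n+1} < ‖ϖ‖^{3n} = ‖ψ(⊗_b ϖ_b³)_j‖` for every `j` — whereas with ONE tame factor
of degree `≥ 2` the trace-zero part reaches the top polyshell (`Thm311RealInd1StripPacketHullWashout`). [cite: Mochizuki2012, IUTchIV Prop. 1.4
(i) p. 13] [cite: NeukirchANT1999, Ch. II Prop. (5.5), (5.7)] [claim: Mochizuki2012, status: disputed] -/
theorem norm_psi_le_of_mem_logPacket_of_trace_eq_zero (b₀ : I) {x : PacketAlgebra 2 k} (hx : x ∈ logPacket 2 k)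
    (htr : Algebra.trace ℚ_[2] (PacketAlgebra 2 k) x = 0) (j : J) :
    ‖ψ x j‖ ≤ ‖(ϖ b₀ : k b₀)‖ ^ (3 * Fintype.card I + 1) ∧
      ‖(ϖ b₀ : k b₀)‖ ^ (3 * Fintype.card I + 1) < ‖ψ (purePacket 2 k (fun b => (ϖ b : k b) ^ 3)) j‖ := by
  have h := (norm_psi_sub_traceRatio_smul_le_of_mem_logPacket k L ψ hι he hf hϖ b₀ hx j).1
  rw [htr, zero_div, zero_smul, sub_zero] at h
  refine ⟨h, ?_⟩
  rw [(purePacket_pow_three_mem_logPacket_and_norm k L ψ hι he hf hϖ b₀ j).2]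
  exact pow_lt_pow_right_of_lt_one₀ (norm_units_pos (ϖ b₀)) (hϖ b₀).1 (by omega)

include hϖ hι he hf in
/-- **TOP POLYSHELL ⟺ UNIT TRACE RATIO** (all components at once): for `x ∈ log₂(R_I^×)` and any component `j`,
`‖ψ(x)_j‖ = ‖ϖ‖^{3n}` ⟺ `‖Tr_V(x)‖ = ‖Tr_V(⊗_b ϖ_b³)‖`. [cite: Mochizuki2012, IUTchIV Prop. 1.4 (i) p. 13] [cite: NeukirchANT1999, Ch. II
Prop. (5.5), (5.7)] [claim: Mochizuki2012, status: disputed] -/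
theorem norm_psi_eq_top_iff_of_mem_logPacket (b₀ : I) {x : PacketAlgebra 2 k} (hx : x ∈ logPacket 2 k) (j : J) :
    ‖ψ x j‖ = ‖(ϖ b₀ : k b₀)‖ ^ (3 * Fintype.card I) ↔
      ‖Algebra.trace ℚ_[2] (PacketAlgebra 2 k) x‖ =
        ‖Algebra.trace ℚ_[2] (PacketAlgebra 2 k) (purePacket 2 k (fun b => (ϖ b : k b) ^ 3))‖ := by
  obtain ⟨hcong, hle⟩ := norm_psi_sub_traceRatio_smul_le_of_mem_logPacket k L ψ hι he hf hϖ b₀ hx j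
  obtain ⟨-, hπn⟩ := purePacket_pow_three_mem_logPacket_and_norm k L ψ hι he hf hϖ b₀ j
  have hΘ0 := trace_purePacket_pow_three_ne_zero k hι he hf hϖ
  set ρ : ℝ := ‖(ϖ b₀ : k b₀)‖ with hρ
  have hρ0 : 0 < ρ := norm_units_pos (ϖ b₀)
  have hρ1 : ρ < 1 := (hϖ b₀).1
  set t : ℚ_[2] := Algebra.trace ℚ_[2] (PacketAlgebra 2 k) x /
    Algebra.trace ℚ_[2] (PacketAlgebra 2 k) (purePacket 2 k (fun b => (ϖ b : k b) ^ 3)) with ht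
  have ht1 : ‖t‖ ≤ 1 := by rw [ht, norm_div]; exact div_le_one_of_le₀ hle (norm_nonneg _)
  have hiff : ‖Algebra.trace ℚ_[2] (PacketAlgebra 2 k) x‖ =
      ‖Algebra.trace ℚ_[2] (PacketAlgebra 2 k) (purePacket 2 k (fun b => (ϖ b : k b) ^ 3))‖ ↔ ‖t‖ = 1 := by
    rw [ht, norm_div, div_eq_one_iff_eq (norm_ne_zero_iff.mpr hΘ0)]
  have hlt : ρ ^ (3 * Fintype.card I + 1) < ρ ^ (3 * Fintype.card I) := pow_lt_pow_right_of_lt_one₀ hρ0 hρ1 (by omega)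
  have hts : ‖t • ψ (purePacket 2 k (fun b => (ϖ b : k b) ^ 3)) j‖ = ‖t‖ * ρ ^ (3 * Fintype.card I) := by rw [norm_smul, hπn]
  rw [hiff]
  constructor
  · intro htop
    by_contra ht1'
    have ht2 : ‖t‖ ≤ 2⁻¹ := padic_norm_le_half_of_norm_lt_one' (lt_of_le_of_ne ht1 ht1')
    have hρ2 : (2⁻¹ : ℝ) = ρ ^ 2 := by rw [hρ, WildQuadraticDyadic.norm_unif_sq (hϖ b₀) (he b₀)]
    have hsm : ‖t • ψ (purePacket 2 k (fun b => (ϖ b : k b) ^ 3)) j‖ < ρ ^ (3 * Fintype.card I) := by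
      rw [hts]
      calc ‖t‖ * ρ ^ (3 * Fintype.card I) ≤ ρ ^ 2 * ρ ^ (3 * Fintype.card I) :=
          mul_le_mul_of_nonneg_right (ht2.trans hρ2.le) (pow_nonneg hρ0.le _)
        _ = ρ ^ (3 * Fintype.card I + 2) := by rw [← pow_add, add_comm]
        _ < ρ ^ (3 * Fintype.card I) := pow_lt_pow_right_of_lt_one₀ hρ0 hρ1 (by omega)
    have : ‖ψ x j‖ < ρ ^ (3 * Fintype.card I) := by
      have h := IsUltrametricDist.norm_add_le_max (ψ x j - t • ψ (purePacket 2 k (fun b => (ϖ b : k b) ^ 3)) j)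
        (t • ψ (purePacket 2 k (fun b => (ϖ b : k b) ^ 3)) j)
      rw [sub_add_cancel] at h
      exact h.trans_lt (max_lt (hcong.trans_lt hlt) hsm)
    exact absurd htop this.ne
  · intro ht1e
    have hts' : ‖t • ψ (purePacket 2 k (fun b => (ϖ b : k b) ^ 3)) j‖ = ρ ^ (3 * Fintype.card I) := by rw [hts, ht1e, one_mul]
    have hlt' : ‖ψ x j - t • ψ (purePacket 2 k (fun b => (ϖ b : k b) ^ 3)) j‖ <
        ‖t • ψ (purePacket 2 k (fun b => (ϖ b : k b) ^ 3)) j‖ := by rw [hts']; exact hcong.trans_lt hlt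
    have h := IsUltrametricDist.norm_add_eq_max_of_norm_ne_norm hlt'.ne
    rw [sub_add_cancel, max_eq_right hlt'.le, hts'] at h
    exact h

end Packet

end TraceZeroDyadicSqrtNegOne

end Literature.IUT.LogVolume

end
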